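import Summits.BirchSwinnertonDyer.BirchSwinnertonDyer.Theses.ResidualThetaTransportAtTwo
import Summits.BirchSwinnertonDyer.BirchSwinnertonDyer.Theorems.ResidualThetaTransportAtTwoSignedMuVanishingAtTwoPlusLineV46
import Summits.BirchSwinnertonDyer.BirchSwinnertonDyer.Theorems.ResidualThetaTransportAtTwoThetaLayerLambdaCongruenceAtTwoCuspSpanArtinReduction
import HarnessLib

/-!
# Crux Kμ⁺ `SignedMuVanishingAtTwoPlus` (stmt-BirchSwinnertonDyer-20689), line `birth` v4.7: the crux BY NAME from
# {seed 21438, PUB⁵ 27435, Artin's primitive-root conjecture (AP₃)}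

Cell `bsd-wall`, lead `bsd-wall-rtt-p4` g8 (helper, `--supports stmt-BirchSwinnertonDyer-20689`; THEOREMS ONLY — no `def`, no
named fact, no `sorry`). BSD is not proved by this; every hypothesis below is an OPEN ledger item, a print fact taken by name, or
the classical conjecture (AP₃) taken as an inline hypothesis.

v4.6 (`…LineV46`, p629737) keyed the line to its ledger cone {21438 `SignedMuSeedAtTwoPlus`, 27435 `PublishedInputsHeckeAtTwo`,
27436 `CuspSpanEvenAtTwoOdd`}. Since then the node 27436 has a kernel closer from ONE classical conjecture
(`SignedMuAtTwo.cuspSpanEvenAtTwoOdd_of_artin`, extra width seat rtt-p3-w5 g0, p630531):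
  (AP₃)  for all `M r B` with `8 ∣ M`, `r ≡ 3 (mod 8)`, `gcd(r, M) = 1` there is a prime `q > B`, `q ≡ r (mod M)`, such that
         every non-zero residue mod `q` is a power of `2`
— Artin's conjecture for the base `2` on progressions `≡ 3 (mod 8)`, a theorem under GRH (Hooley 1967; Lenstra 1977 (8.3);
Moree 1999 Thm. 2 and Thm. 4), open unconditionally. This file substitutes that closer for the node:

* `flatMuZeroAtTwo_of_artin` — the registered stub `FlatMuZeroAtTwo` of line `birth` (verbatim) from (AP₃);
* `signedMuAnalyticAtTwoPlus_of_pub_of_artin` — the analytic child 21437 from item 27435 ∧ (AP₃);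
* `signedMuVanishingAtTwoPlus_of_seed_of_abbesUllmo_of_artin`, `signedMuVanishingAtTwoPlus_of_seed_of_pub_of_artin` — the crux
  from {item 21438, Abbes–Ullmo Thm A | item 27435, (AP₃)};
* `signedMuVanishingAtTwoPlus_iff_seed_of_pub_of_artin` — granted item 27435 and (AP₃), the crux IS the μ-seed item 21438.

So, modulo the print bundle and one GRH-class classical conjecture, Kμ⁺ along line `birth` is EXACTLY the algebraic μ-seed 21438
(signed `μ⁺ = 0` with torsion at `2` on the habitat⁺; by the crux-ideate memo `Cruxes/SignedMuSeedAtTwoPlus/SEED-FINE-HALF-CUBIC-MU-k1g8.md`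
its fine half is Iwasawa's `μ₂ = 0` for the cubic 2-division field `L_W`). References: C. Hooley, J. reine angew. Math. 225 (1967)
[Hooley1967]; H. W. Lenstra, Invent. Math. 42 (1977) Thm. (8.3) [Lenstra1977]; P. Moree, J. Number Theory 78 (1999) Thm. 2, Thm. 4
[Moree1999]; R. Pollack, Duke Math. J. 118 (2003) Conj. 6.3 [Pollack2003]; A. Abbes, E. Ullmo, Compositio Math. 103 (1996) Thm. A
[AbbesUllmo1996]; R. Greenberg, LNM 1716 (1999) Conj. 1.11 [Greenberg1999LNM].
-/

set_option autoImplicit false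
-- justification: the `Summit.BirchSwinnertonDyer.BirchSwinnertonDyer.…` path repeats a component (route-file convention)
set_option linter.dupNamespace false

noncomputable section

open scoped Classical MatrixGroups ModularForm

open CongruenceSubgroup WeierstrassCurve Literature.NumberTheory.EllipticCurves
  Literature.NumberTheory.EllipticCurves.ModularForms Literature.NumberTheory.EllipticCurves.Rank1Residual
  Literature.NumberTheory.IwasawaTheory Summit.BirchSwinnertonDyer.Rank1Residual.Supersingular
  Summit.BirchSwinnertonDyer.BirchSwinnertonDyer.Theses.ResidualThetaTransportAtTwo

namespace Summit.BirchSwinnertonDyer.BirchSwinnertonDyer.Theorems.SignedMuAtTwo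

/-- **(AP₃) ⟹ the registered stub `FlatMuZeroAtTwo`** of line `birth` (verbatim: on the habitat⁺, `2 ∤ L♭` for every Pollack
pair at `2` of the newform of `W`): Artin's conjecture for `2` on progressions `≡ 3 (mod 8)` gives `CuspSpanEvenAtTwo N` at every
odd level (`forall_cuspSpanEvenAtTwo_of_artin`), and the named road `flatMuZeroAtTwo_of_forall_cuspSpanEvenAtTwo` closes the stub.
Conditional on (AP₃); BSD is not proved by this. [cite: Lenstra1977, Thm. (8.3)] [cite: Moree1999, Thm. 2 and Thm. 4]
[cite: Pollack2003, Conj. 6.3 and Prop. 6.18] -/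
theorem flatMuZeroAtTwo_of_artin
    (hAP : ∀ (M r B : ℕ), 8 ∣ M → r % 8 = 3 → Nat.Coprime r M →
      ∃ q : ℕ, q.Prime ∧ B < q ∧ q ≡ r [MOD M] ∧ ∀ x : ZMod q, x ≠ 0 → ∃ i : ℕ, (2 : ZMod q) ^ i = x) :
    ∀ (W : WeierstrassCurve ℚ) [W.IsElliptic] [W.IsGloballyMinimal], ¬ W.HasCM → W.analyticRank = 0 →
      GoodSS W 2 → W.frobeniusTrace 2 = 0 → W.Δ < 0 →
      ∀ [NeZero (W.conductorNorm ℤ)] (f : CuspForm (Gamma0 (W.conductorNorm ℤ)) 2), IsNewformOf W f →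
      ∀ (Lplus Lminus : IwasawaAlgebra 2), IsPollackPair f 2 Lplus Lminus → ¬ PowerSeries.C (2 : ℤ_[2]) ∣ Lminus :=
  flatMuZeroAtTwo_of_forall_cuspSpanEvenAtTwo (forall_cuspSpanEvenAtTwo_of_artin hAP)

/-- **PUB⁵ bundle item 27435 ∧ (AP₃) ⟹ the analytic child 21437 `SignedMuAnalyticAtTwoPlus`** — through the v4.6 closer
`signedMuAnalyticAtTwoPlus_of_pub_of_cuspSpanEvenAtTwoOdd` and the node closer `cuspSpanEvenAtTwoOdd_of_artin` (p630531); only the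
fifth conjunct (Abbes–Ullmo Thm A) of the bundle is used. Conditional; BSD is not proved by this.
[cite: AbbesUllmo1996, Thm. A] [cite: Lenstra1977, Thm. (8.3)] [cite: Pollack2003, Conj. 6.3 and Prop. 6.18] -/
theorem signedMuAnalyticAtTwoPlus_of_pub_of_artin (hPub : PublishedInputsHeckeAtTwo)
    (hAP : ∀ (M r B : ℕ), 8 ∣ M → r % 8 = 3 → Nat.Coprime r M →
      ∃ q : ℕ, q.Prime ∧ B < q ∧ q ≡ r [MOD M] ∧ ∀ x : ZMod q, x ≠ 0 → ∃ i : ℕ, (2 : ZMod q) ^ i = x) :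
    SignedMuAnalyticAtTwoPlus :=
  signedMuAnalyticAtTwoPlus_of_pub_of_cuspSpanEvenAtTwoOdd hPub (cuspSpanEvenAtTwoOdd_of_artin hAP)

/-- **The crux Kμ⁺ BY NAME from {seed item 21438, Abbes–Ullmo Thm A (print), (AP₃)}**: the seed closes the algebraic half
through the proved propagation at `2` (`signedMuVanishingAtTwoPlus_of_analytic_of_seed`, p585569); the period fact and (AP₃) close
the analytic half (`signedMuAnalyticAtTwoPlus_of_abbesUllmo_of_forall_cuspSpanEvenAtTwo` ∘ `forall_cuspSpanEvenAtTwo_of_artin`).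
Conditional on one open item, one print fact and (AP₃); BSD is not proved by this.
[cite: Greenberg1999LNM, Conj. 1.11] [cite: AbbesUllmo1996, Thm. A] [cite: Lenstra1977, Thm. (8.3)] -/
theorem signedMuVanishingAtTwoPlus_of_seed_of_abbesUllmo_of_artin (hSeed : SignedMuSeedAtTwoPlus)
    (hAU : abbesUllmo_not_dvd_maninConstant_of_not_dvd_level)
    (hAP : ∀ (M r B : ℕ), 8 ∣ M → r % 8 = 3 → Nat.Coprime r M →
      ∃ q : ℕ, q.Prime ∧ B < q ∧ q ≡ r [MOD M] ∧ ∀ x : ZMod q, x ≠ 0 → ∃ i : ℕ, (2 : ZMod q) ^ i = x) :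
    SignedMuVanishingAtTwoPlus :=
  signedMuVanishingAtTwoPlus_of_analytic_of_seed
    (signedMuAnalyticAtTwoPlus_of_abbesUllmo_of_forall_cuspSpanEvenAtTwo hAU (forall_cuspSpanEvenAtTwo_of_artin hAP)) hSeed

/-- **The crux Kμ⁺ BY NAME from {seed item 21438, PUB⁵ bundle item 27435, (AP₃)}** — the ledger cone of line `birth` with the
node item 27436 replaced by Artin's conjecture for `2` on progressions `≡ 3 (mod 8)` (GRH-conditional in print). Conditional; BSD is
not proved by this. [cite: Greenberg1999LNM, Conj. 1.11] [cite: AbbesUllmo1996, Thm. A] [cite: Moree1999, Thm. 2 and Thm. 4] -/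
theorem signedMuVanishingAtTwoPlus_of_seed_of_pub_of_artin (hSeed : SignedMuSeedAtTwoPlus) (hPub : PublishedInputsHeckeAtTwo)
    (hAP : ∀ (M r B : ℕ), 8 ∣ M → r % 8 = 3 → Nat.Coprime r M →
      ∃ q : ℕ, q.Prime ∧ B < q ∧ q ≡ r [MOD M] ∧ ∀ x : ZMod q, x ≠ 0 → ∃ i : ℕ, (2 : ZMod q) ^ i = x) :
    SignedMuVanishingAtTwoPlus :=
  signedMuVanishingAtTwoPlus_of_analytic_of_seed (signedMuAnalyticAtTwoPlus_of_pub_of_artin hPub hAP) hSeed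

/-- **Granted the PUB⁵ bundle item 27435 and (AP₃), the crux Kμ⁺ IS the μ-seed item 21438** (kernel-exact:
`signedMuVanishingAtTwoPlus_iff_analytic_and_seed`; the direction crux ⟹ seed is `A := W`). So, modulo print and one GRH-class
classical conjecture, Kμ⁺ along line `birth` is exactly signed `μ⁺ = 0` with torsion at `2` on the habitat⁺. BSD is not proved by
this. [cite: Greenberg1999LNM, Conj. 1.11] [cite: Lenstra1977, Thm. (8.3)] -/
theorem signedMuVanishingAtTwoPlus_iff_seed_of_pub_of_artin (hPub : PublishedInputsHeckeAtTwo)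
    (hAP : ∀ (M r B : ℕ), 8 ∣ M → r % 8 = 3 → Nat.Coprime r M →
      ∃ q : ℕ, q.Prime ∧ B < q ∧ q ≡ r [MOD M] ∧ ∀ x : ZMod q, x ≠ 0 → ∃ i : ℕ, (2 : ZMod q) ^ i = x) :
    SignedMuVanishingAtTwoPlus ↔ SignedMuSeedAtTwoPlus :=
  ⟨fun h ↦ (signedMuVanishingAtTwoPlus_iff_analytic_and_seed.mp h).2,
    fun hSeed ↦ signedMuVanishingAtTwoPlus_of_seed_of_pub_of_artin hSeed hPub hAP⟩

end Summit.BirchSwinnertonDyer.BirchSwinnertonDyer.Theorems.SignedMuAtTwo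

end
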